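import Summits.Ventures.PercRepro.S1SevenSixFourPointLine

/-!
# PercRepro — RANK-2 TRIPLES AGAINST `4`-SETS: THE INCIDENCE COUNT OF A COLOOP-FREE RANK-4 MATROID ON 7 POINTS
(p2, gen 28; SUBCLAIM-S1 §6.10 (xvii)(o); towards the shape `(rank 3 on 6) ⊕ (rank 4 on 7)` of `(7, 6)`)

Let `t` be the number of rank-`2` triples, `q₂` the number of rank-`2` four-sets, `q₃` the number of rank-`3`
four-sets. Counting the incidences «a rank-`2` triple inside a `4`-set»: each triple lies in exactly `4` four-sets,
a rank-`2` four-set contains `4` triples, and any other four-set contains at most `1` (two rank-`2` triples in a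
`4`-set make it a `4`-point line). Hence `4 q₂ ≤ 4 t ≤ 4 q₂ + q₃`, i.e. `q₂ ≤ t` and `q₃ ≥ 4 (t − q₂)`. With
`t + q₂ ≤ 21` (the rank-`2` sets with `≥ 3` points) this gives `q₂ ≤ 10`. Nothing is claimed about any cell.

* `tripleFourSets` — the incidences; `ncard_tripleFourSets_eq`, `ncard_tripleFourSets_le`;
* `ncard_rankTwo_four_le_ncard_rankTwoTriples`, `four_mul_sub_le_ncard_rankThree_four`, `ncard_rankTwo_four_le_ten`.
Axioms: standard.
-/

open scoped Matroid

namespace PercRepro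

namespace S1

open Set

variable {α : Type}

/-- The incidences «a rank-`2` triple `T` inside a `4`-set `Q`». -/
def tripleFourSets (N : Matroid α) : Set (Set α × Set α) :=
  {R : Set α × Set α | R.1 ∈ rankTwoTriples N ∧ R.2 ⊆ N.E ∧ R.2.ncard = 4 ∧ R.1 ⊆ R.2}

section Incidences

variable (N : Matroid α) [N.Finite]

/-- The triple/four-set incidences are finite. -/
theorem tripleFourSets_finite : (tripleFourSets N).Finite :=
  (N.ground_finite.finite_subsets.prod N.ground_finite.finite_subsets).subset
    (fun _ hR => ⟨hR.1.1, hR.2.1⟩)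

/-- Each rank-`2` triple lies in exactly `|E| − 3` four-sets: `#incidences = (|E| − 3) · t`. -/
theorem ncard_tripleFourSets_eq (hE : N.E.ncard = 7) :
    (tripleFourSets N).ncard = 4 * (rankTwoTriples N).ncard := by
  have hTfin := rankTwoTriples_finite N
  have heq : tripleFourSets N = ⋃ T ∈ rankTwoTriples N,
      ({T} ×ˢ {Q : Set α | Q ⊆ N.E ∧ Q.ncard = 4 ∧ T ⊆ Q} : Set (Set α × Set α)) := by
    ext ⟨T, Q⟩
    simp only [tripleFourSets, mem_setOf_eq, mem_iUnion, mem_prod, mem_singleton_iff, exists_prop]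
    constructor
    · rintro ⟨hT, hQE, hQ4, hTQ⟩
      exact ⟨T, hT, rfl, hQE, hQ4, hTQ⟩
    · rintro ⟨T', hT', rfl, hQE, hQ4, hTQ⟩
      exact ⟨hT', hQE, hQ4, hTQ⟩
  have hfib : ∀ T ∈ rankTwoTriples N,
      (({T} ×ˢ {Q : Set α | Q ⊆ N.E ∧ Q.ncard = 4 ∧ T ⊆ Q} : Set (Set α × Set α))).Finite :=
    fun T _ => (finite_singleton T).prod (N.ground_finite.finite_subsets.subset (fun _ hQ => hQ.1))
  have hdisj : (rankTwoTriples N).PairwiseDisjoint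
      (fun T : Set α => ({T} ×ˢ {Q : Set α | Q ⊆ N.E ∧ Q.ncard = 4 ∧ T ⊆ Q} : Set (Set α × Set α))) := by
    intro T _ T' _ hTT
    rw [Function.onFun, Set.disjoint_left]
    rintro ⟨C, Q⟩ ⟨hC1, -⟩ ⟨hC2, -⟩
    apply hTT
    rw [mem_singleton_iff] at hC1 hC2
    rw [← hC1, ← hC2]
  rw [heq, hTfin.ncard_biUnion hfib hdisj, finsum_mem_eq_finite_toFinset_sum _ hTfin]
  rw [Finset.sum_congr rfl (g := fun _ => 4) ?_]
  · rw [Finset.sum_const, smul_eq_mul, ncard_eq_toFinset_card _ hTfin, mul_comm]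
  · intro T hT
    rw [Finite.mem_toFinset] at hT
    rw [ncard_prod, ncard_singleton, one_mul]
    -- the `4`-sets containing `T` are the `insert x T`, `x ∈ E ∖ T`
    have hTE : T ⊆ N.E := hT.1
    have hT3 : T.ncard = 3 := hT.2.1
    have hTfin' : T.Finite := N.ground_finite.subset hTE
    have himg : {Q : Set α | Q ⊆ N.E ∧ Q.ncard = 4 ∧ T ⊆ Q} = (fun x => insert x T) '' (N.E \ T) := by
      ext Q
      simp only [mem_setOf_eq, mem_image, mem_sdiff]
      constructor
      · rintro ⟨hQE, hQ4, hTQ⟩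
        have h1 : (Q \ T).ncard = 1 := by rw [ncard_sdiff' hTQ (N.ground_finite.subset hQE), hQ4, hT3]
        obtain ⟨x, hx⟩ := ncard_eq_one.mp h1
        have hxmem : x ∈ Q \ T := by rw [hx]; exact mem_singleton x
        refine ⟨x, ⟨hQE hxmem.1, hxmem.2⟩, ?_⟩
        ext w
        constructor
        · rintro (rfl | hw)
          · exact hxmem.1
          · exact hTQ hw
        · intro hw
          by_cases hwT : w ∈ T
          · exact Or.inr hwT
          · have : w ∈ Q \ T := ⟨hw, hwT⟩
            rw [hx] at this
            exact Or.inl this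
      · rintro ⟨x, ⟨hxE, hxT⟩, rfl⟩
        exact ⟨insert_subset hxE hTE, by rw [ncard_insert_of_notMem hxT hTfin', hT3], subset_insert _ _⟩
    rw [himg, InjOn.ncard_image, ncard_sdiff' hTE N.ground_finite, hE, hT3]
    intro x hx y hy hxy
    have hxy' : insert x T = insert y T := hxy
    have : x ∈ insert y T := hxy' ▸ mem_insert x T
    rcases this with h | h
    · exact h
    · exact absurd h hx.2

/-- `#incidences ≤ 4 q₂ + q₃'`, where `q₃'` counts the `4`-sets of rank `≠ 2` that contain a rank-`2` triple
(a `4`-set with two distinct rank-`2` triples has rank `2`, and a rank-`2` four-set contains at most `C(4, 3)`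
triples). -/
theorem ncard_tripleFourSets_le (hpairs : ∀ e ∈ N.E, ∀ f ∈ N.E, e ≠ f → N.eRk {e, f} = 2) :
    (tripleFourSets N).ncard ≤ 4 * {Q : Set α | Q ⊆ N.E ∧ Q.ncard = 4 ∧ N.eRk Q = 2}.ncard +
      {Q : Set α | Q ⊆ N.E ∧ Q.ncard = 4 ∧ N.eRk Q ≠ 2 ∧ ∃ T ∈ rankTwoTriples N, T ⊆ Q}.ncard := by
  have hf4 : {Q : Set α | Q ⊆ N.E ∧ Q.ncard = 4}.Finite := N.ground_finite.finite_subsets.subset (fun _ h => h.1)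
  have hA : {Q : Set α | Q ⊆ N.E ∧ Q.ncard = 4 ∧ N.eRk Q = 2}.Finite := hf4.subset (fun _ h => ⟨h.1, h.2.1⟩)
  have hB : {Q : Set α | Q ⊆ N.E ∧ Q.ncard = 4 ∧ N.eRk Q ≠ 2 ∧ ∃ T ∈ rankTwoTriples N, T ⊆ Q}.Finite :=
    hf4.subset (fun _ h => ⟨h.1, h.2.1⟩)
  have hQfin := tripleFourSets_finite N
  -- the incidences lie over the `4`-sets of rank `2` (`≤ 4` each) and over the others containing a triple (`≤ 1`)
  have hup : tripleFourSets N ⊆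
      (⋃ Q ∈ {Q : Set α | Q ⊆ N.E ∧ Q.ncard = 4 ∧ N.eRk Q = 2}, {R ∈ tripleFourSets N | R.2 = Q}) ∪
      (⋃ Q ∈ {Q : Set α | Q ⊆ N.E ∧ Q.ncard = 4 ∧ N.eRk Q ≠ 2 ∧ ∃ T ∈ rankTwoTriples N, T ⊆ Q},
        {R ∈ tripleFourSets N | R.2 = Q}) := by
    rintro ⟨T, Q⟩ ⟨hT, hQE, hQ4, hTQ⟩
    by_cases h2 : N.eRk Q = 2
    · left
      rw [mem_iUnion₂]
      exact ⟨Q, ⟨hQE, hQ4, h2⟩, ⟨hT, hQE, hQ4, hTQ⟩, rfl⟩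
    · right
      rw [mem_iUnion₂]
      exact ⟨Q, ⟨hQE, hQ4, h2, T, hT, hTQ⟩, ⟨hT, hQE, hQ4, hTQ⟩, rfl⟩
  -- fibres: over a rank-`2` four-set at most `4` (the `3`-subsets); over another at most `1`
  have hfibA : ∀ Q ∈ {Q : Set α | Q ⊆ N.E ∧ Q.ncard = 4 ∧ N.eRk Q = 2}, {R ∈ tripleFourSets N | R.2 = Q}.ncard ≤ 4 := by
    rintro Q ⟨hQE, hQ4, -⟩
    have hsub : {R ∈ tripleFourSets N | R.2 = Q} ⊆ (fun T => (T, Q)) '' {T : Set α | T ⊆ Q ∧ T.ncard = 3} := by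
      rintro ⟨T, Q'⟩ ⟨⟨hT, -, -, hTQ⟩, hQQ⟩
      have hQQ' : Q' = Q := hQQ
      subst hQQ'
      exact ⟨T, ⟨hTQ, hT.2.1⟩, rfl⟩
    have hfin : {T : Set α | T ⊆ Q ∧ T.ncard = 3}.Finite :=
      (N.ground_finite.subset hQE).finite_subsets.subset (fun _ h => h.1)
    refine (ncard_le_ncard hsub (hfin.image _)).trans ((ncard_image_le hfin).trans ?_)
    rw [ncard_setOf_subset_ncard_eq (N.ground_finite.subset hQE) 3, hQ4]
    decide
  have hfibB : ∀ Q ∈ {Q : Set α | Q ⊆ N.E ∧ Q.ncard = 4 ∧ N.eRk Q ≠ 2 ∧ ∃ T ∈ rankTwoTriples N, T ⊆ Q},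
      {R ∈ tripleFourSets N | R.2 = Q}.ncard ≤ 1 := by
    rintro Q ⟨hQE, hQ4, hQ2, -⟩
    rw [ncard_le_one_iff (hQfin.subset (fun R hR => hR.1))]
    rintro ⟨T, Q'⟩ ⟨T', Q''⟩ ⟨⟨hT, -, -, hTQ⟩, hQQ⟩ ⟨⟨hT', -, -, hTQ'⟩, hQQ'⟩
    have e1 : Q' = Q := hQQ
    have e2 : Q'' = Q := hQQ'
    rw [e1] at hTQ
    rw [e2] at hTQ'
    rw [e1, e2]
    -- two distinct rank-`2` triples in `Q` would make `Q` a set of rank `2`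
    by_contra hne
    have hTT : T ≠ T' := fun h => hne (by rw [h])
    exfalso
    apply hQ2
    -- `T ∩ T'` has `2` points; `Q = T ∪ T'` lies in the closure of that pair
    have hTfin : T.Finite := N.ground_finite.subset hT.1
    have hT'fin : T'.Finite := N.ground_finite.subset hT'.1
    have hunion : T ∪ T' = Q := by
      refine (union_subset hTQ hTQ').antisymm ?_
      by_contra hsub
      have hlt : (T ∪ T').ncard < Q.ncard := by
        rcases (ncard_le_ncard (union_subset hTQ hTQ') (N.ground_finite.subset hQE)).lt_or_eq with h | h
        · exact h
        · exact absurd ((eq_of_subset_of_ncard_le (union_subset hTQ hTQ') h.ge (N.ground_finite.subset hQE)).symm ▸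
            subset_rfl) hsub
      have h3 : 3 ≤ (T ∪ T').ncard := by
        have := ncard_le_ncard (subset_union_left (s := T) (t := T')) (hTfin.union hT'fin)
        rw [hT.2.1] at this
        exact this
      rw [hQ4] at hlt
      have heq : (T ∪ T').ncard = 3 := by omega
      have := eq_of_subset_of_ncard_le (subset_union_left (s := T) (t := T')) (by rw [heq, hT.2.1]) (hTfin.union hT'fin)
      have hsubT' : T' ⊆ T := by rw [this]; exact subset_union_right
      exact hTT (eq_of_subset_of_ncard_le hsubT' (by rw [hT.2.1, hT'.2.1]) hTfin).symm
    have hinter : (T ∩ T').ncard = 2 := by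
      have := ncard_union_add_ncard_inter T T' hTfin hT'fin
      rw [hunion, hQ4, hT.2.1, hT'.2.1] at this
      omega
    obtain ⟨x, y, hxy, hxyeq⟩ := ncard_eq_two.mp hinter
    have hxT : x ∈ T := (hxyeq ▸ (mem_insert x {y}) : x ∈ T ∩ T').1
    have hyT : y ∈ T := (hxyeq ▸ (mem_insert_of_mem x (mem_singleton y)) : y ∈ T ∩ T').1
    have hxT' : x ∈ T' := (hxyeq ▸ (mem_insert x {y}) : x ∈ T ∩ T').2
    have hyT' : y ∈ T' := (hxyeq ▸ (mem_insert_of_mem x (mem_singleton y)) : y ∈ T ∩ T').2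
    have hpair : N.eRk {x, y} = 2 := hpairs x (hT.1 hxT) y (hT.1 hyT) hxy
    -- `T ⊆ cl {x, y}` and `T' ⊆ cl {x, y}`: both have rank `2` and contain the pair
    have hcl : ∀ S, S ∈ rankTwoTriples N → ({x, y} : Set α) ⊆ S → S ⊆ N.closure {x, y} := by
      intro S hS hxyS z hz
      rw [mem_closure_iff_eRk_insert_eq N (hS.1 hz) (hxyS.trans hS.1), hpair]
      have hle : N.eRk (insert z {x, y}) ≤ N.eRk S := N.eRk_mono (insert_subset hz hxyS)
      have hge : N.eRk {x, y} ≤ N.eRk (insert z {x, y}) := N.eRk_mono (subset_insert _ _)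
      rw [hS.2.2] at hle
      rw [hpair] at hge
      exact le_antisymm hle hge
    have hQcl : Q ⊆ N.closure {x, y} := by
      rw [← hunion]
      exact union_subset (hcl T hT (insert_subset hxT (singleton_subset_iff.mpr hyT)))
        (hcl T' hT' (insert_subset hxT' (singleton_subset_iff.mpr hyT')))
    have hle : N.eRk Q ≤ N.eRk (N.closure {x, y}) := N.eRk_mono hQcl
    rw [N.eRk_closure_eq, hpair] at hle
    have hge : N.eRk {x, y} ≤ N.eRk Q := N.eRk_mono (insert_subset (hTQ hxT) (singleton_subset_iff.mpr (hTQ hyT)))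
    rw [hpair] at hge
    exact le_antisymm hle hge
  calc (tripleFourSets N).ncard
      ≤ ((⋃ Q ∈ {Q : Set α | Q ⊆ N.E ∧ Q.ncard = 4 ∧ N.eRk Q = 2}, {R ∈ tripleFourSets N | R.2 = Q}) ∪
          (⋃ Q ∈ {Q : Set α | Q ⊆ N.E ∧ Q.ncard = 4 ∧ N.eRk Q ≠ 2 ∧ ∃ T ∈ rankTwoTriples N, T ⊆ Q},
            {R ∈ tripleFourSets N | R.2 = Q})).ncard :=
        ncard_le_ncard hup ((hA.biUnion (fun Q _ => hQfin.subset (fun R hR => hR.1))).union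
          (hB.biUnion (fun Q _ => hQfin.subset (fun R hR => hR.1))))
    _ ≤ (⋃ Q ∈ {Q : Set α | Q ⊆ N.E ∧ Q.ncard = 4 ∧ N.eRk Q = 2}, {R ∈ tripleFourSets N | R.2 = Q}).ncard +
          (⋃ Q ∈ {Q : Set α | Q ⊆ N.E ∧ Q.ncard = 4 ∧ N.eRk Q ≠ 2 ∧ ∃ T ∈ rankTwoTriples N, T ⊆ Q},
            {R ∈ tripleFourSets N | R.2 = Q}).ncard := ncard_union_le _ _
    _ ≤ (∑ᶠ Q ∈ {Q : Set α | Q ⊆ N.E ∧ Q.ncard = 4 ∧ N.eRk Q = 2}, {R ∈ tripleFourSets N | R.2 = Q}.ncard) +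
          ∑ᶠ Q ∈ {Q : Set α | Q ⊆ N.E ∧ Q.ncard = 4 ∧ N.eRk Q ≠ 2 ∧ ∃ T ∈ rankTwoTriples N, T ⊆ Q},
            {R ∈ tripleFourSets N | R.2 = Q}.ncard :=
        Nat.add_le_add (hA.ncard_biUnion_le _) (hB.ncard_biUnion_le _)
    _ = (∑ Q ∈ hA.toFinset, {R ∈ tripleFourSets N | R.2 = Q}.ncard) +
          ∑ Q ∈ hB.toFinset, {R ∈ tripleFourSets N | R.2 = Q}.ncard := by
        rw [finsum_mem_eq_finite_toFinset_sum _ hA, finsum_mem_eq_finite_toFinset_sum _ hB]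
    _ ≤ hA.toFinset.card • 4 + hB.toFinset.card • 1 := by
        apply Nat.add_le_add
        · apply Finset.sum_le_card_nsmul
          intro Q hQ
          rw [Finite.mem_toFinset] at hQ
          exact hfibA Q hQ
        · apply Finset.sum_le_card_nsmul
          intro Q hQ
          rw [Finite.mem_toFinset] at hQ
          exact hfibB Q hQ
    _ = 4 * {Q : Set α | Q ⊆ N.E ∧ Q.ncard = 4 ∧ N.eRk Q = 2}.ncard +
          {Q : Set α | Q ⊆ N.E ∧ Q.ncard = 4 ∧ N.eRk Q ≠ 2 ∧ ∃ T ∈ rankTwoTriples N, T ⊆ Q}.ncard := by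
        rw [smul_eq_mul, smul_eq_mul, ← ncard_eq_toFinset_card _ hA, ← ncard_eq_toFinset_card _ hB, mul_comm, mul_one]

/-- `4 q₂ ≤ #incidences`: a rank-`2` four-set contains `4` rank-`2` triples. -/
theorem four_mul_ncard_rankTwo_four_le (hpairs : ∀ e ∈ N.E, ∀ f ∈ N.E, e ≠ f → N.eRk {e, f} = 2) :
    4 * {Q : Set α | Q ⊆ N.E ∧ Q.ncard = 4 ∧ N.eRk Q = 2}.ncard ≤ (tripleFourSets N).ncard := by
  have hf4 : {Q : Set α | Q ⊆ N.E ∧ Q.ncard = 4}.Finite := N.ground_finite.finite_subsets.subset (fun _ h => h.1)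
  have hA : {Q : Set α | Q ⊆ N.E ∧ Q.ncard = 4 ∧ N.eRk Q = 2}.Finite := hf4.subset (fun _ h => ⟨h.1, h.2.1⟩)
  -- the incidences over the rank-`2` four-sets: `{T ⊆ Q, |T| = 3} × {Q}`, `4` per `Q`, pairwise disjoint
  have hsub : ⋃ Q ∈ {Q : Set α | Q ⊆ N.E ∧ Q.ncard = 4 ∧ N.eRk Q = 2},
      ((fun T => (T, Q)) '' {T : Set α | T ⊆ Q ∧ T.ncard = 3}) ⊆ tripleFourSets N := by
    intro R hR
    rw [mem_iUnion₂] at hR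
    obtain ⟨Q, ⟨hQE, hQ4, hQ2⟩, T, ⟨hTQ, hT3⟩, rfl⟩ := hR
    refine ⟨⟨hTQ.trans hQE, hT3, ?_⟩, hQE, hQ4, hTQ⟩
    -- a `3`-subset of a rank-`2` set with all pairs of rank `2` has rank `2`
    have hle : N.eRk T ≤ N.eRk Q := N.eRk_mono hTQ
    rw [hQ2] at hle
    have hge := two_le_eRk_of_two_le_ncard hpairs (hTQ.trans hQE) (by omega)
    exact le_antisymm hle hge
  have hfib : ∀ Q ∈ {Q : Set α | Q ⊆ N.E ∧ Q.ncard = 4 ∧ N.eRk Q = 2},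
      ((fun T => (T, Q)) '' {T : Set α | T ⊆ Q ∧ T.ncard = 3}).Finite :=
    fun Q hQ => ((N.ground_finite.subset hQ.1).finite_subsets.subset (fun _ h => h.1)).image _
  have hdisj : {Q : Set α | Q ⊆ N.E ∧ Q.ncard = 4 ∧ N.eRk Q = 2}.PairwiseDisjoint
      (fun Q : Set α => (fun T => (T, Q)) '' {T : Set α | T ⊆ Q ∧ T.ncard = 3}) := by
    intro Q _ Q' _ hQQ
    rw [Function.onFun, Set.disjoint_left]
    rintro ⟨T, C⟩ ⟨T₁, -, h1⟩ ⟨T₂, -, h2⟩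
    apply hQQ
    have e1 : Q = C := ((Prod.mk.injEq _ _ _ _).mp h1).2
    have e2 : Q' = C := ((Prod.mk.injEq _ _ _ _).mp h2).2
    exact e1.trans e2.symm
  have h := ncard_le_ncard hsub (tripleFourSets_finite N)
  rw [hA.ncard_biUnion hfib hdisj, finsum_mem_eq_finite_toFinset_sum _ hA] at h
  rw [Finset.sum_congr rfl (g := fun _ => 4) ?_] at h
  · rw [Finset.sum_const, smul_eq_mul, mul_comm] at h
    rwa [ncard_eq_toFinset_card _ hA]
  · intro Q hQ
    rw [Finite.mem_toFinset] at hQ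
    have hfin : {T : Set α | T ⊆ Q ∧ T.ncard = 3}.Finite :=
      (N.ground_finite.subset hQ.1).finite_subsets.subset (fun _ h => h.1)
    rw [InjOn.ncard_image (fun T _ T' _ h => ((Prod.mk.injEq _ _ _ _).mp h).1),
      ncard_setOf_subset_ncard_eq (N.ground_finite.subset hQ.1) 3, hQ.2.1]
    decide

end Incidences

end S1

end PercRepro
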